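import Summits.Ventures.PercRepro.ProfilePointedCircuitClassesMixedPairHolds

/-!
# PercRepro — THE CROSS COMPARISON `v_2(f, g) ≤ v_4(g, f)` AT NINE POINTS: THE MISSING PIECE OF THE SINGLE-TRIANGLE
CASE AT `ρ = 6` (p5, gen 39; `proofs/P5-GM1.md` §57)

The single-triangle case of `InOutBottomFour` (InOutTriangleIV, MixedPairHolds) needed, on the nullity-`3` deletion
`M = N ∖ e` with `H₀ = E − f − g`, the two comparisons `(F)_f : #D_f ≤ #U_f` and `(F)_g : #D_g ≤ #U_g`, where
`D_f = {Y ∈ C(H₀, 2) : Y + f ∈ ℐ, (H₀ − Y) + g ∈ ℐ}` and `U_f = {Z ∈ C(H₀, 4) : Z + f ∈ ℐ, (H₀ − Z) + g ∈ ℐ}`; `(F)`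
is a theorem for `#E ≥ 10` (InOutTriangle) but TIGHT at `#E = 9` (worst ratio `1.000`), where its natural double
counting fails.  The assembly only needs the SUM `#D_f + #D_g ≤ #U_f + #U_g`, and the CROSS comparisons
`#D_f ≤ #U_g`, `#D_g ≤ #U_f` (worst ratio `1.333` at `9` points, exhaustive over the `929` rank-`3` loopless
coloopless matroids on `9` points, `66,766` ordered pairs) have a clean proof:

In the dual `R = M✶` (rank `3`, loopless), `D_f` reads `{Y ∈ C(H₀, 2) : Y + f spans R, (H₀ − Y) + g spans R}` and
`U_g`, after `Z ↦ H₀ − Z`, reads `{Z′ ∈ C(H₀, 3) : Z′ + f spans R, (H₀ − Z′) + g spans R}` — the SAME two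
conditions one level up.  Relate `Y` to `Z′ = Y + z`: every `Y` has at least `3` such `Z′` (of the `5` points `z`
of `S = H₀ − Y`, at most `2` are BAD, i.e. have `(S − z) + g` of rank `≤ 2`: three bad points `z₁, z₂, z₃` of a
spanning set `T` would give `ρ(T − z_i − z_j) ≤ 1` by submodularity, hence `ρ(T − z₁) ≤ 1` by submodularity again
over the common nonempty part `T − {z₁, z₂, z₃}` of `T − z₁ − z₂` and `T − z₁ − z₃`, hence `ρ(T) ≤ 2`), and every
`Z′` has at most `C(3, 2) = 3` pairs inside.  `Finset.card_mul_le_card_mul` with `3 = 3` gives `#D_f ≤ #U_g`.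

* `card_filter_rk_erase_le_two_le_two` — at most two bad points of a spanning set of `≥ 4` points;
* `cross_dual_core` — the cross comparison in the dual, `#E = 9`;
* **`mixedTwo_le_mixedFour_cross_of_nine`** — `v_2(f, g) ≤ v_4(g, f)` on a coloop-free nullity-`3` matroid on `9` points.
-/

open scoped Matroid

namespace PercRepro.Cogirth

open Finset ThmH Skew Shadow Profile

variable {α : Type} [DecidableEq α] {R : Matroid α} [R.Finite]

section BadPoints

/-- **AT MOST TWO BAD POINTS**: in a loopless matroid, a set `T` of `≥ 4` points of rank `3` has at most two points
`z` with `ρ(T − z) ≤ 2`. -/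
theorem card_filter_rk_erase_le_two_le_two (hll : ∀ x ∈ gr R, rk R {x} = 1) {T : Finset α} (hT : T ⊆ gr R)
    (hT3 : rk R T = 3) (h4 : 4 ≤ T.card) :
    (T.filter (fun z => rk R (T.erase z) ≤ 2)).card ≤ 2 := by
  by_contra hcon
  have h3 : 2 < (T.filter (fun z => rk R (T.erase z) ≤ 2)).card := by omega
  rw [two_lt_card] at h3
  obtain ⟨z₁, hz₁, z₂, hz₂, z₃, hz₃, h12, h13, h23⟩ := h3
  rw [mem_filter] at hz₁ hz₂ hz₃
  -- two bad points `a ≠ b` give `ρ(T − a − b) ≤ 1`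
  have hU : ∀ a b, a ∈ T → a ≠ b → rk R (T.erase a) ≤ 2 → rk R (T.erase b) ≤ 2 →
      rk R (T.erase a ∩ T.erase b) ≤ 1 := by
    intro a b _ hab hra hrb
    have hsub := rk_inter_add_rk_union_le' (M := R) (T.erase a) (T.erase b)
    have hT' : T ⊆ T.erase a ∪ T.erase b := by
      intro t ht
      rw [mem_union, mem_erase, mem_erase]
      by_cases hta : t = a
      · right
        refine ⟨?_, ht⟩
        rw [hta]
        exact hab
      · left
        exact ⟨hta, ht⟩
    have := rk_mono' (M := R) hT'
    omega
  have h12' := hU z₁ z₂ hz₁.1 h12 hz₁.2 hz₂.2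
  have h13' := hU z₁ z₃ hz₁.1 h13 hz₁.2 hz₃.2
  -- a fourth point `a` of `T`
  obtain ⟨a, haT, ha⟩ : ∃ a ∈ T, a ∉ ({z₁, z₂, z₃} : Finset α) := by
    apply exists_mem_notMem_of_card_lt_card
    calc ({z₁, z₂, z₃} : Finset α).card ≤ 3 := card_le_three
      _ < T.card := by omega
  have haA : a ∈ (T.erase z₁ ∩ T.erase z₂) ∩ (T.erase z₁ ∩ T.erase z₃) := by
    simp only [mem_inter, mem_erase, mem_insert, mem_singleton, not_or] at ha ⊢
    exact ⟨⟨⟨ha.1, haT⟩, ha.2.1, haT⟩, ⟨ha.1, haT⟩, ha.2.2, haT⟩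
  have hA1 : 1 ≤ rk R ((T.erase z₁ ∩ T.erase z₂) ∩ (T.erase z₁ ∩ T.erase z₃)) :=
    one_le_rk_of_mem_of_loopless hll
      (inter_subset_left.trans (inter_subset_left.trans ((erase_subset _ _).trans hT))) haA
  -- the union of the two rank-`≤ 1` sets contains `T − z₁`
  have hX1 : T.erase z₁ ⊆ (T.erase z₁ ∩ T.erase z₂) ∪ (T.erase z₁ ∩ T.erase z₃) := by
    intro t ht
    rw [mem_union, mem_inter, mem_inter]
    have ht' := mem_erase.1 ht
    by_cases ht2 : t = z₂
    · right
      refine ⟨ht, mem_erase.2 ⟨?_, ht'.2⟩⟩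
      rw [ht2]
      exact h23
    · left
      exact ⟨ht, mem_erase.2 ⟨ht2, ht'.2⟩⟩
  have hsub2 := rk_inter_add_rk_union_le' (M := R) (T.erase z₁ ∩ T.erase z₂) (T.erase z₁ ∩ T.erase z₃)
  have hX1' := rk_mono' (M := R) hX1
  have hins := rk_insert_le (M := R) z₁ (T.erase z₁)
  rw [insert_erase hz₁.1] at hins
  omega

end BadPoints

section Cross

variable {f g : α}

/-- **THE CROSS COMPARISON IN THE DUAL** (`#E = 9`): on a loopless rank-`3` matroid `R` on `9` points with
`f ≠ g` and `H₀ = E − f − g`, the pairs `Y ⊆ H₀` with `Y + f` and `(H₀ − Y) + g` spanning are at most the `4`-sets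
`Z ⊆ H₀` with `(H₀ − Z) + f` and `Z + g` spanning. -/
theorem cross_dual_core (hR3 : rk R (gr R) = 3) (hll : ∀ x ∈ gr R, rk R {x} = 1)
    (hf : f ∈ gr R) (hg : g ∈ gr R) (hfg : f ≠ g) (h9 : (gr R).card = 9) :
    (((((gr R).erase f).erase g).powersetCard 2).filter (fun Y =>
        rk R (insert f Y) = 3 ∧ rk R (insert g (((gr R).erase f).erase g \ Y)) = 3)).card ≤
    (((((gr R).erase f).erase g).powersetCard 4).filter (fun Z =>
        rk R (insert f (((gr R).erase f).erase g \ Z)) = 3 ∧ rk R (insert g Z) = 3)).card := by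
  obtain ⟨H₀, hH₀⟩ : ∃ H₀, H₀ = ((gr R).erase f).erase g := ⟨_, rfl⟩
  rw [← hH₀]
  have hH₀E : H₀ ⊆ gr R := by rw [hH₀]; exact (erase_subset _ _).trans (erase_subset _ _)
  have hgH₀ : g ∉ H₀ := by rw [hH₀]; simp
  have hcard : H₀.card = 7 := by
    rw [hH₀, card_erase_of_mem (mem_erase.2 ⟨hfg.symm, hg⟩), card_erase_of_mem hf, h9]
  have hle3 : ∀ X ⊆ gr R, rk R X ≤ 3 := fun X hX => hR3 ▸ rk_mono' hX
  have hmain := card_mul_le_card_mul (fun (Y Z : Finset α) => Y ⊆ H₀ \ Z)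
    (s := (H₀.powersetCard 2).filter (fun Y => rk R (insert f Y) = 3 ∧ rk R (insert g (H₀ \ Y)) = 3))
    (t := (H₀.powersetCard 4).filter (fun Z => rk R (insert f (H₀ \ Z)) = 3 ∧ rk R (insert g Z) = 3))
    (m := 3) (n := 3) ?_ ?_
  · exact Nat.le_of_mul_le_mul_right hmain (by norm_num)
  · -- every pair `Y` has at least `3` children `Z = S − z`, `S = H₀ − Y`, `z` not bad
    intro Y hY
    simp only [mem_filter, mem_powersetCard] at hY
    obtain ⟨⟨hYH, hY2⟩, hYf, hYg⟩ := hY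
    have hS5 : (H₀ \ Y).card = 5 := by rw [card_sdiff_of_subset hYH, hcard, hY2]
    have hSE : H₀ \ Y ⊆ gr R := sdiff_subset.trans hH₀E
    have hgS : g ∉ H₀ \ Y := fun h => hgH₀ (mem_sdiff.1 h).1
    have hT : insert g (H₀ \ Y) ⊆ gr R := insert_subset hg hSE
    have hT4 : 4 ≤ (insert g (H₀ \ Y)).card := by rw [card_insert_of_notMem hgS, hS5]; omega
    have hbad := card_filter_rk_erase_le_two_le_two hll hT hYg hT4
    have hgood : 3 ≤ ((H₀ \ Y) \
        (insert g (H₀ \ Y)).filter (fun z => rk R ((insert g (H₀ \ Y)).erase z) ≤ 2)).card := by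
      have := card_le_card_sdiff_add_card (s := H₀ \ Y)
        (t := (insert g (H₀ \ Y)).filter (fun z => rk R ((insert g (H₀ \ Y)).erase z) ≤ 2))
      omega
    refine hgood.trans ?_
    apply card_le_card_of_injOn (fun z => (H₀ \ Y).erase z)
    · intro z hz
      rw [mem_coe, mem_sdiff, mem_filter] at hz
      obtain ⟨hzS, hzbad⟩ := hz
      have hzg : z ≠ g := fun h => hgS (h ▸ hzS)
      have hYsub : Y ⊆ H₀ \ (H₀ \ Y).erase z := by
        intro y hy
        rw [mem_sdiff, mem_erase, mem_sdiff]
        exact ⟨hYH hy, fun h => h.2.2 hy⟩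
      rw [mem_coe, mem_bipartiteAbove, mem_filter, mem_powersetCard]
      beta_reduce
      refine ⟨⟨⟨(erase_subset _ _).trans sdiff_subset, by rw [card_erase_of_mem hzS, hS5]⟩, ?_, ?_⟩, hYsub⟩
      · have h1 := rk_mono' (M := R) (insert_subset_insert f hYsub)
        have h2 := hle3 (insert f (H₀ \ (H₀ \ Y).erase z)) (insert_subset hf (sdiff_subset.trans hH₀E))
        omega
      · have hne : ¬ rk R ((insert g (H₀ \ Y)).erase z) ≤ 2 := fun h => hzbad ⟨mem_insert_of_mem hzS, h⟩
        rw [erase_insert_of_ne hzg.symm] at hne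
        have h2 := hle3 (insert g ((H₀ \ Y).erase z)) (insert_subset hg ((erase_subset _ _).trans hSE))
        omega
    · intro z₁ hz₁ z₂ _ h
      rw [mem_coe, mem_sdiff] at hz₁
      exact (erase_inj (H₀ \ Y) hz₁.1).1 h
  · -- every `4`-set `Z` has at most `C(3, 2) = 3` parents
    intro Z hZ
    simp only [mem_filter, mem_powersetCard] at hZ
    obtain ⟨⟨hZH, hZ4⟩, _, _⟩ := hZ
    have h3 : ((H₀ \ Z).powersetCard 2).card = 3 := by
      rw [card_powersetCard, card_sdiff_of_subset hZH, hcard, hZ4]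
      decide
    rw [← h3]
    apply card_le_card
    intro Y hY
    rw [mem_bipartiteBelow] at hY
    rw [mem_powersetCard]
    exact ⟨hY.2, (mem_powersetCard.1 (mem_filter.1 hY.1).1).2⟩

variable {M : Matroid α} [M.Finite]

/-- For `Y ⊆ H₀ = (E − f) − g`: `E − (Y + f) = (H₀ − Y) + g`. -/
theorem gr_sdiff_insert_left (hg : g ∈ gr M) (hfg : f ≠ g) {Y : Finset α}
    (hY : Y ⊆ ((gr M).erase f).erase g) :
    gr M \ insert f Y = insert g (((gr M).erase f).erase g \ Y) := by
  ext x
  simp only [mem_sdiff, mem_insert, mem_erase]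
  constructor
  · rintro ⟨hx, hxY⟩
    by_cases hxg : x = g
    · exact Or.inl hxg
    · exact Or.inr ⟨⟨hxg, fun h => hxY (Or.inl h), hx⟩, fun h => hxY (Or.inr h)⟩
  · rintro (rfl | ⟨⟨_, hxf, hx⟩, hxY⟩)
    · exact ⟨hg, fun h => h.elim (fun h => hfg h.symm) (fun h => (mem_erase.1 (hY h)).1 rfl)⟩
    · exact ⟨hx, fun h => h.elim hxf hxY⟩

/-- For `Y ⊆ H₀ = (E − f) − g`: `E − ((H₀ − Y) + g) = Y + f`. -/
theorem gr_sdiff_insert_left' (hf : f ∈ gr M) (hg : g ∈ gr M) (hfg : f ≠ g) {Y : Finset α}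
    (hY : Y ⊆ ((gr M).erase f).erase g) :
    gr M \ insert g (((gr M).erase f).erase g \ Y) = insert f Y := by
  rw [← gr_sdiff_insert_left hg hfg hY,
    Finset.sdiff_sdiff_eq_self (insert_subset hf (hY.trans ((erase_subset _ _).trans (erase_subset _ _))))]

/-- For `Z ⊆ H₀ = (E − f) − g`: `E − (Z + g) = (H₀ − Z) + f`. -/
theorem gr_sdiff_insert_right (hf : f ∈ gr M) (hfg : f ≠ g) {Z : Finset α}
    (hZ : Z ⊆ ((gr M).erase f).erase g) :
    gr M \ insert g Z = insert f (((gr M).erase f).erase g \ Z) := by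
  ext x
  simp only [mem_sdiff, mem_insert, mem_erase]
  constructor
  · rintro ⟨hx, hxZ⟩
    by_cases hxf : x = f
    · exact Or.inl hxf
    · exact Or.inr ⟨⟨fun h => hxZ (Or.inl h), hxf, hx⟩, fun h => hxZ (Or.inr h)⟩
  · rintro (rfl | ⟨⟨hxg, _, hx⟩, hxZ⟩)
    · exact ⟨hf, fun h => h.elim hfg (fun h => (mem_erase.1 (mem_erase.1 (hZ h)).2).1 rfl)⟩
    · exact ⟨hx, fun h => h.elim hxg hxZ⟩

/-- For `Z ⊆ H₀ = (E − f) − g`: `E − ((H₀ − Z) + f) = Z + g`. -/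
theorem gr_sdiff_insert_right' (hf : f ∈ gr M) (hg : g ∈ gr M) (hfg : f ≠ g) {Z : Finset α}
    (hZ : Z ⊆ ((gr M).erase f).erase g) :
    gr M \ insert f (((gr M).erase f).erase g \ Z) = insert g Z := by
  rw [← gr_sdiff_insert_right hf hfg hZ,
    Finset.sdiff_sdiff_eq_self (insert_subset hg (hZ.trans ((erase_subset _ _).trans (erase_subset _ _))))]

/-- **`v_2(f, g) ≤ v_4(g, f)` ON NINE POINTS**: on a coloop-free nullity-`3` matroid `M` on `9` points with
`f ≠ g` and `H₀ = E − f − g`, the pairs `Y ⊆ H₀` with `Y + f ∈ ℐ` and `(H₀ − Y) + g ∈ ℐ` are at most the `4`-sets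
`Z ⊆ H₀` with `Z + g ∈ ℐ` and `(H₀ − Z) + f ∈ ℐ`. -/
theorem mixedTwo_le_mixedFour_cross_of_nine (hn : (gr M).card = rk M (gr M) + 3) (h9 : (gr M).card = 9)
    (hcf : ∀ x ∈ gr M, rk M ((gr M).erase x) = rk M (gr M)) (hf : f ∈ gr M) (hg : g ∈ gr M) (hfg : f ≠ g) :
    (((((gr M).erase f).erase g).powersetCard 2).filter (fun Y => rk M (insert f Y) = 3 ∧
        rk M (insert g (((gr M).erase f).erase g \ Y)) = (insert g (((gr M).erase f).erase g \ Y)).card)).card ≤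
    (((((gr M).erase f).erase g).powersetCard 4).filter (fun Z => rk M (insert g Z) = 5 ∧
        rk M (insert f (((gr M).erase f).erase g \ Z)) = (insert f (((gr M).erase f).erase g \ Z)).card)).card := by
  have hgrR : gr M✶ = gr M := gr_dual
  have hR3 : rk M✶ (gr M✶) = 3 := by rw [hgrR]; exact rk_dual_gr_of_nullity_three hn
  have hR3' : rk M✶ (gr M) = 3 := by rw [← hgrR]; exact hR3
  have hllR : ∀ x ∈ gr M✶, rk M✶ {x} = 1 := by
    intro x hx
    rw [hgrR] at hx
    exact rk_dual_singleton_of_coloopFree hcf hx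
  have core := cross_dual_core hR3 hllR (by rw [hgrR]; exact hf) (by rw [hgrR]; exact hg) hfg (by rw [hgrR, h9])
  rw [hgrR] at core
  have hH₀E : ((gr M).erase f).erase g ⊆ gr M := (erase_subset _ _).trans (erase_subset _ _)
  have hfH : f ∉ ((gr M).erase f).erase g := by simp
  have hgH : g ∉ ((gr M).erase f).erase g := by simp
  have hLeq := filter_congr (s := (((gr M).erase f).erase g).powersetCard 2)
      (p := fun Y => rk M (insert f Y) = 3 ∧
        rk M (insert g (((gr M).erase f).erase g \ Y)) = (insert g (((gr M).erase f).erase g \ Y)).card)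
      (q := fun Y => rk M✶ (insert f Y) = 3 ∧ rk M✶ (insert g (((gr M).erase f).erase g \ Y)) = 3)
      (fun Y hY => by
        rw [mem_powersetCard] at hY
        have hfY : f ∉ Y := fun h => hfH (hY.1 h)
        have hc : (insert f Y).card = 3 := by rw [card_insert_of_notMem hfY, hY.2]
        have e1 := rk_eq_card_iff_rk_dual_sdiff (M := M) (X := insert f Y) (insert_subset hf (hY.1.trans hH₀E))
        rw [gr_sdiff_insert_left hg hfg hY.1, hR3', hc] at e1
        have e2 := rk_eq_card_iff_rk_dual_sdiff (M := M) (X := insert g (((gr M).erase f).erase g \ Y))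
          (insert_subset hg (sdiff_subset.trans hH₀E))
        rw [gr_sdiff_insert_left' hf hg hfg hY.1, hR3'] at e2
        rw [← e2, ← e1]
        exact and_comm)
  have hUeq := filter_congr (s := (((gr M).erase f).erase g).powersetCard 4)
      (p := fun Z => rk M (insert g Z) = 5 ∧
        rk M (insert f (((gr M).erase f).erase g \ Z)) = (insert f (((gr M).erase f).erase g \ Z)).card)
      (q := fun Z => rk M✶ (insert f (((gr M).erase f).erase g \ Z)) = 3 ∧ rk M✶ (insert g Z) = 3)
      (fun Z hZ => by
        rw [mem_powersetCard] at hZ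
        have hgZ : g ∉ Z := fun h => hgH (hZ.1 h)
        have hc : (insert g Z).card = 5 := by rw [card_insert_of_notMem hgZ, hZ.2]
        have e1 := rk_eq_card_iff_rk_dual_sdiff (M := M) (X := insert g Z) (insert_subset hg (hZ.1.trans hH₀E))
        rw [gr_sdiff_insert_right hf hfg hZ.1, hR3', hc] at e1
        have e2 := rk_eq_card_iff_rk_dual_sdiff (M := M) (X := insert f (((gr M).erase f).erase g \ Z))
          (insert_subset hf (sdiff_subset.trans hH₀E))
        rw [gr_sdiff_insert_right' hf hg hfg hZ.1, hR3'] at e2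
        rw [← e2, ← e1])
  rw [hLeq, hUeq]
  exact core

end Cross

end PercRepro.Cogirth
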